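import Mathlib
import HarnessLib

/-!
# The reflecting-end modes are pairwise orthogonal: `Σ_{x<T} cos(πm(x+½)/T) = 0` unless `2T ∣ m`, hence `Σ_x c_k(x) c_l(x) = 0` for `k ≠ l < T` and `Σ_x c_k(x)² = T/2` (`0 < k < T`)

HONEST FRAMING: exact (Metropolis-corrected) sampling algorithms for lattice gauge theory;
figures of merit are autocorrelation/cost numbers at stated couplings and volumes; no
continuum-physics claim.

Venture `LatticeQCDFlow` (cell pub-lqcd), sub-topic `Scaling`; FANOUT row 21 (`su3-base`, the
OBC-HMC arm).  NEW WORK of the cell (placement rule), Mathlib-only, elementary; no definition is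
introduced; nothing is cited as a fact; no number of ours.  Companion of row 21 GEN-8's
`Scaling/OpenBoundaryDiffusionMode` (the profiles `c_k(x) = cos(πk(x+½)/T)`, `k = 0, …, T − 1`, are
exact eigenvectors of the reflecting-end second difference on `T` slices with eigenvalues
`λ_k = 4 sin²(πk/2T)`; the slowest mode relaxes in time `Θ(T²)`).  This file supplies the missing
half of "the `λ_k` are THE spectrum": the `T` profiles are pairwise orthogonal and non-zero (so they
are `T` linearly independent eigenvectors in dimension `T`) — the discrete cosine (DCT-II)
orthogonality.

The key sum: for an integer `m` NOT divisible by `2T`,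

  `Σ_{x=0}^{T−1} cos(π m (x + ½)/T) = 0`.

Proof: with `u = e^{iπm/(2T)}` the sum is `Re Σ_x u^{2x+1}`, and
`(u − ū) Σ_x u^{2x+1} = u^{2T} − 1 = e^{iπm} − 1` is REAL while `u − ū = 2i sin(πm/2T)` is purely
imaginary and non-zero; so the sum is purely imaginary.  Products of two modes reduce to such sums
with `m = k ∓ l`, and `0 < |k − l| < 2T`, `0 < k + l < 2T` for distinct `k, l < T`.

## What is proved

* `odd_powers_telescope` — `(u² − 1) Σ_{x<T} u^{2x+1} = u^{2T+1} − u`;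
* **`sum_cos_halfShift_eq_zero`** — `¬ 2T ∣ m ⟹ Σ_{x<T} cos(πm(x+½)/T) = 0` (`T ≥ 1`, `m ∈ ℤ`);
* **`cos_modes_orthogonal`** — `k ≠ l`, `k, l < T ⟹ Σ_{x<T} c_k(x) c_l(x) = 0`;
* **`cos_mode_sum_sq`** — `0 < k < T ⟹ Σ_{x<T} c_k(x)² = T/2`; `cos_mode_zero_sum_sq` (`k = 0`: `= T`);
  `cos_mode_ne_zero` — every profile has a non-zero entry (at `x = 0`: `cos(πk/2T) > 0` for `k < T`);

* **`cos_modes_linearIndependent`** — the `T` modes are linearly independent over `ℝ` (so, as `T`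
  eigenvectors in dimension `T`, they exhaust the spectrum of the caricature).

NOT CLAIMED: the packaging as an orthonormal eigenbasis of a named operator / a spectral-theorem
statement; anything about the OBC arm's data.
-/

namespace Summit.Ventures.LatticeQCDFlow.Scaling

open Finset Complex

/-! ## §1 The half-shifted cosine sum -/

/-- Telescoping of odd powers: `(u² − 1) Σ_{x<T} u^{2x+1} = u^{2T+1} − u`. -/
theorem odd_powers_telescope (u : ℂ) (T : ℕ) :
    (u ^ 2 - 1) * ∑ x ∈ range T, u ^ (2 * x + 1) = u ^ (2 * T + 1) - u := by
  induction T with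
  | zero => simp
  | succ n ih =>
    rw [sum_range_succ, mul_add, ih]
    ring_nf

/-- **`Σ_{x<T} cos(π m (x + ½)/T) = 0` whenever `2T ∤ m`** (`T ≥ 1`, `m` an integer). -/
theorem sum_cos_halfShift_eq_zero {T : ℕ} (hT : 0 < T) {m : ℤ} (hm : ¬ ((2 * T : ℤ) ∣ m)) :
    ∑ x ∈ range T, Real.cos (Real.pi * m * (x + 1 / 2) / T) = 0 := by
  have hT0 : (T : ℝ) ≠ 0 := by exact_mod_cast hT.ne'
  set φ : ℝ := Real.pi * m / (2 * T) with hφ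
  set u : ℂ := Complex.exp ((φ : ℂ) * Complex.I) with hu
  -- each term is the real part of an odd power of `u`
  have hterm : ∀ x : ℕ, Real.cos (Real.pi * m * (x + 1 / 2) / T) = (u ^ (2 * x + 1)).re := by
    intro x
    rw [hu, ← Complex.exp_nat_mul]
    have h : ((2 * x + 1 : ℕ) : ℂ) * ((φ : ℂ) * Complex.I) = (((2 * x + 1) * φ : ℝ) : ℂ) * Complex.I := by
      push_cast; ring
    rw [h, Complex.exp_ofReal_mul_I_re]
    congr 1
    rw [hφ]
    field_simp
  -- the sum as a real part
  set S : ℂ := ∑ x ∈ range T, u ^ (2 * x + 1) with hS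
  have hre : ∑ x ∈ range T, Real.cos (Real.pi * m * (x + 1 / 2) / T) = S.re := by
    rw [hS, Complex.re_sum]
    exact Finset.sum_congr rfl fun x _ => hterm x
  -- `u ū = 1`
  have huu : u * (starRingEnd ℂ) u = 1 := by
    rw [hu, ← Complex.exp_conj, ← Complex.exp_add]
    simp [Complex.conj_ofReal]
  -- `S (u − ū) = u^{2T} − 1`
  have hkey : S * (u - (starRingEnd ℂ) u) = u ^ (2 * T) - 1 := by
    have h := odd_powers_telescope u T
    -- multiply `h` by `ū` and use `u ū = 1`
    have h2 : S * (u - (starRingEnd ℂ) u) = (starRingEnd ℂ) u * ((u ^ 2 - 1) * S) := by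
      linear_combination (-(S * u)) * huu
    rw [h2, h]
    linear_combination (u ^ (2 * T) - 1) * huu
  -- `u^{2T} = e^{iπm}` has zero imaginary part
  have him : (u ^ (2 * T) - 1).im = 0 := by
    rw [hu, ← Complex.exp_nat_mul]
    have hT0' : (T : ℂ) ≠ 0 := by exact_mod_cast hT.ne'
    have h : ((2 * T : ℕ) : ℂ) * ((φ : ℂ) * Complex.I) = (((m : ℝ) * Real.pi : ℝ) : ℂ) * Complex.I := by
      rw [hφ]; push_cast; field_simp
    rw [h, Complex.sub_im, Complex.exp_ofReal_mul_I_im, Complex.one_im, sub_zero]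
    exact Real.sin_int_mul_pi m
  -- `u − ū = 2 i sin φ` with `sin φ ≠ 0`
  have hsub : u - (starRingEnd ℂ) u = ((2 * Real.sin φ : ℝ) : ℂ) * Complex.I := by
    rw [Complex.sub_conj, hu, Complex.exp_ofReal_mul_I_im]
  have hsin : Real.sin φ ≠ 0 := by
    intro h0
    rw [Real.sin_eq_zero_iff] at h0
    obtain ⟨n, hn⟩ := h0
    apply hm
    refine ⟨n, ?_⟩
    rw [hφ] at hn
    have hπ : Real.pi ≠ 0 := Real.pi_ne_zero
    have h1 : (m : ℝ) = 2 * T * n := by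
      field_simp at hn
      linarith
    exact_mod_cast h1
  -- take imaginary parts of `hkey`: `2 sin φ · Re S = 0`
  have h2 : 2 * Real.sin φ * S.re = 0 := by
    have h := congrArg Complex.im hkey
    rw [him, hsub] at h
    simp only [Complex.mul_im, Complex.mul_re, Complex.ofReal_re, Complex.ofReal_im, Complex.I_re,
      Complex.I_im, mul_zero, sub_zero, mul_one, add_zero] at h
    linarith
  have hS0 : S.re = 0 := by
    have h2' : (2 * Real.sin φ) * S.re = 0 := h2
    rcases mul_eq_zero.mp h2' with h | h
    · exact absurd (by linarith : Real.sin φ = 0) hsin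
    · exact h
  rw [hre, hS0]

/-! ## §2 Orthogonality and norms of the reflecting-end modes -/

/-- **Distinct modes are orthogonal**: for `k ≠ l`, both `< T`,
`Σ_{x<T} cos(πk(x+½)/T) cos(πl(x+½)/T) = 0`. -/
theorem cos_modes_orthogonal {T k l : ℕ} (hk : k < T) (hl : l < T) (hkl : k ≠ l) :
    ∑ x ∈ range T, Real.cos (Real.pi * k * (x + 1 / 2) / T) * Real.cos (Real.pi * l * (x + 1 / 2) / T)
      = 0 := by
  have hT : 0 < T := lt_of_le_of_lt (Nat.zero_le k) hk
  -- neither `k − l` nor `k + l` is a multiple of `2T`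
  have hdiff : ¬ ((2 * T : ℤ) ∣ ((k : ℤ) - l)) := by
    rintro ⟨c, hc⟩
    rcases lt_trichotomy c 0 with h | h | h
    · have : c ≤ -1 := by omega
      nlinarith
    · subst h; simp at hc; omega
    · have : 1 ≤ c := by omega
      nlinarith
  have hsum : ¬ ((2 * T : ℤ) ∣ ((k : ℤ) + l)) := by
    rintro ⟨c, hc⟩
    rcases lt_trichotomy c 0 with h | h | h
    · have : c ≤ -1 := by omega
      nlinarith
    · subst h; simp at hc; omega
    · have : 1 ≤ c := by omega
      nlinarith
  have h1 := sum_cos_halfShift_eq_zero hT hdiff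
  have h2 := sum_cos_halfShift_eq_zero hT hsum
  -- product to sum
  have hps : ∀ x : ℕ, Real.cos (Real.pi * k * (x + 1 / 2) / T) * Real.cos (Real.pi * l * (x + 1 / 2) / T)
      = (Real.cos (Real.pi * (((k : ℤ) - l : ℤ) : ℝ) * (x + 1 / 2) / T)
          + Real.cos (Real.pi * (((k : ℤ) + l : ℤ) : ℝ) * (x + 1 / 2) / T)) / 2 := by
    intro x
    have e1 : Real.pi * (((k : ℤ) - l : ℤ) : ℝ) * (x + 1 / 2) / T =
        Real.pi * k * (x + 1 / 2) / T - Real.pi * l * (x + 1 / 2) / T := by push_cast; ring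
    have e2 : Real.pi * (((k : ℤ) + l : ℤ) : ℝ) * (x + 1 / 2) / T =
        Real.pi * k * (x + 1 / 2) / T + Real.pi * l * (x + 1 / 2) / T := by push_cast; ring
    rw [e1, e2, Real.cos_sub, Real.cos_add]
    ring
  simp_rw [hps, ← Finset.sum_div, Finset.sum_add_distrib]
  push_cast at h1 h2 ⊢
  rw [h1, h2]
  norm_num

/-- **`Σ_{x<T} cos²(πk(x+½)/T) = T/2` for `0 < k < T`.** -/
theorem cos_mode_sum_sq {T k : ℕ} (hk0 : 0 < k) (hk : k < T) :
    ∑ x ∈ range T, Real.cos (Real.pi * k * (x + 1 / 2) / T) ^ 2 = T / 2 := by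
  have hT : 0 < T := lt_trans hk0 hk
  have h2k : ¬ ((2 * T : ℤ) ∣ ((2 * k : ℕ) : ℤ)) := by
    rintro ⟨c, hc⟩
    push_cast at hc
    rcases lt_trichotomy c 0 with h | h | h
    · have : c ≤ -1 := by omega
      nlinarith
    · subst h; simp at hc; omega
    · have : 1 ≤ c := by omega
      nlinarith
  have h1 := sum_cos_halfShift_eq_zero hT h2k
  have hsq : ∀ x : ℕ, Real.cos (Real.pi * k * (x + 1 / 2) / T) ^ 2 =
      (1 + Real.cos (Real.pi * (((2 * k : ℕ) : ℤ) : ℝ) * (x + 1 / 2) / T)) / 2 := by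
    intro x
    have e : Real.pi * (((2 * k : ℕ) : ℤ) : ℝ) * (x + 1 / 2) / T =
        2 * (Real.pi * k * (x + 1 / 2) / T) := by push_cast; ring
    rw [e, Real.cos_sq]
    ring
  simp_rw [hsq, ← Finset.sum_div, Finset.sum_add_distrib]
  rw [h1, Finset.sum_const, Finset.card_range, nsmul_eq_mul, mul_one, add_zero]

/-- The constant mode `k = 0`: `Σ_{x<T} cos²(0) = T`. -/
theorem cos_mode_zero_sum_sq (T : ℕ) :
    ∑ x ∈ range T, Real.cos (Real.pi * (0 : ℕ) * (x + 1 / 2) / T) ^ 2 = T := by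
  simp

/-- Every mode is non-zero: its `x = 0` entry `cos(πk/2T)` is positive for `k < T`. -/
theorem cos_mode_ne_zero {T k : ℕ} (hk : k < T) :
    0 < Real.cos (Real.pi * k * ((0 : ℕ) + 1 / 2) / T) := by
  have hT : (0 : ℝ) < T := by exact_mod_cast lt_of_le_of_lt (Nat.zero_le k) hk
  apply Real.cos_pos_of_mem_Ioo
  constructor
  · have : 0 ≤ Real.pi * k * ((0 : ℕ) + 1 / 2) / T := by positivity
    linarith [Real.pi_pos]
  · rw [div_lt_iff₀ hT]
    have hk' : (k : ℝ) + 1 ≤ T := by exact_mod_cast hk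
    nlinarith [Real.pi_pos]

/-! ## §3 Linear independence: the `T` modes exhaust the spectrum -/

/-- **The `T` reflecting-end modes are linearly independent** (pairwise orthogonal with positive
self-pairing), hence — being `T` eigenvectors of a symmetric `T × T` matrix — they account for the
whole spectrum `{4 sin²(πk/2T) : k < T}` of the caricature. -/
theorem cos_modes_linearIndependent {T : ℕ} (hT : 0 < T) :
    LinearIndependent ℝ (fun k : Fin T => fun x : Fin T =>
      Real.cos (Real.pi * (k : ℕ) * ((x : ℕ) + 1 / 2) / T)) := by
  have horth : ∀ k l : Fin T, k ≠ l →
      ∑ x : Fin T, Real.cos (Real.pi * (k : ℕ) * ((x : ℕ) + 1 / 2) / T) *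
        Real.cos (Real.pi * (l : ℕ) * ((x : ℕ) + 1 / 2) / T) = 0 := by
    intro k l hkl
    rw [Fin.sum_univ_eq_sum_range (fun x => Real.cos (Real.pi * (k : ℕ) * ((x : ℕ) + 1 / 2) / T) *
        Real.cos (Real.pi * (l : ℕ) * ((x : ℕ) + 1 / 2) / T)) T]
    exact cos_modes_orthogonal k.2 l.2 (fun h => hkl (Fin.ext h))
  have hpos : ∀ k : Fin T, 0 < ∑ x : Fin T, Real.cos (Real.pi * (k : ℕ) * ((x : ℕ) + 1 / 2) / T) *
      Real.cos (Real.pi * (k : ℕ) * ((x : ℕ) + 1 / 2) / T) := by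
    intro k
    rw [Fin.sum_univ_eq_sum_range (fun x => Real.cos (Real.pi * (k : ℕ) * ((x : ℕ) + 1 / 2) / T) *
        Real.cos (Real.pi * (k : ℕ) * ((x : ℕ) + 1 / 2) / T)) T]
    simp_rw [← pow_two]
    by_cases hk0 : (k : ℕ) = 0
    · rw [hk0]
      have h := cos_mode_zero_sum_sq T
      rw [h]
      exact_mod_cast hT
    · rw [cos_mode_sum_sq (Nat.pos_of_ne_zero hk0) k.2]
      have : (0 : ℝ) < T := by exact_mod_cast hT
      linarith
  -- reassociate the products uniformly (the pairing argument below uses `mul_assoc`)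
  simp only [mul_assoc] at horth hpos ⊢
  rw [linearIndependent_iff']
  intro s g hg i hi
  have h := congrArg (fun w : Fin T → ℝ =>
    ∑ x, w x * Real.cos (Real.pi * ((i : ℕ) * ((x : ℕ) + 1 / 2)) / T)) hg
  simp only [Finset.sum_apply, Pi.smul_apply, smul_eq_mul, Pi.zero_apply, zero_mul,
    Finset.sum_const_zero, Finset.sum_mul] at h
  rw [Finset.sum_comm] at h
  simp_rw [mul_assoc, ← Finset.mul_sum] at h
  rw [Finset.sum_eq_single i (fun k _ hki => by rw [horth k i hki, mul_zero])
    (fun h' => absurd hi h')] at h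
  rcases mul_eq_zero.mp h with h0 | h0
  · exact h0
  · exact absurd h0 (hpos i).ne'

end Summit.Ventures.LatticeQCDFlow.Scaling
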